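import Summits.QuantumFields.BalabanUV.Beta.D1BFx.NeedleNdlProjLetters
import Summits.QuantumFields.BalabanUV.Beta.D1BFx.NeedleColumnLetters

/-!
# `BalabanUV.Beta.D1BFx.GluonLocalNdlLetters` — road «BF-x» for binder row D1, slot (K), END row `hGrp gN`, «GN-Q» LETTERS: THE UNIT-DIFFERENCE LETTERS OF THE
# TWO ENDS OF THE `SbT ⊗ ndl` WORD — `|(Ga∇row_u)(x+e_i) − (Ga∇row_u)(x)| ≤ (kΦ′∕n²)·Σ_{s∈B(blk u)}|qJet_u s|·e^{−(ε₁∕n)‖x−s‖}∕nrm(x−s)²` (Φ′: the damped Φ letter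
# gains `1∕nrm`) and `|(Ga∇C_u)(x+e_i) − (Ga∇C_u)(x)| ≤ kN′·(|cQ|·cPPs + cPs)` (kN′: the owner's kN gains `n⁻¹`), modulo [B5, Prop. 1.2] ∧ [B5, (1.126)–(1.127)] BY NAME

HONEST DEPENDENCY (cell records, verbatim): «continuum YM on T⁴ ⇐ BetaPertH ∧ nine spine estimates (0/9 proved); BetaPertH ⇐ (D1) ∧ (D4) ∧
CAP+tail; G-an2-4 gates asym, D1 and NE2/3/4.»  HONEST FRAMING (cell contract, verbatim): «discharging `BetaPertH` makes Bałaban's UV stability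
UNCONDITIONAL — a real constructive-QFT result; it is NOT the continuum limit and NOT the Clay problem.»  THIS MODULE DISCHARGES NOTHING of the
wall: [folklore] lattice bookkeeping BY NAME over leaf-04-g9's LEFT d1 leg profile `GluonLegProfileD1.exists_abs_Ga_diff_left_le_profile` and HLS kit
(`LatticeHLSDamped.abs_sum_mul_le_of_damped_profiles`, `LatticeHLSProfiles.sum_pow_mul_exp_div_nrm_pow_free_scale_le`, `summable_and_abs_tsum_le_of_abs_sum_le`),
gan24-leaf-05-g41's `NeedlePotentialProfile.abs_ndlRow_diff_le_needle_profile`, the owner's `NeedleColumnLetters.abs_gradC_le`.  No `def`, no `def … : Prop`,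
nothing cited, 0 sorry; the printed statements are HYPOTHESES by name.  Root-level binders hW ∕ hR-sockets ∕ hSX-socket ∕ D1Tel ∕ D1Rep — 0 discharged; (K) NOT
closed; NOT D1, NOT `BetaPertH`, NOT continuum, NOT Clay.

ABSOLUTE RULE (cell charter, verbatim): «No internally-minted statement may enter as a cited fact. Every hypothesis is either kernel-proved in
this package or a verbatim quotation of a PUBLISHED theorem with page reference. The manuscript(s) under audit are NOT citable for their own
disputed steps — they are the thing under adjudication; programme-internal (2001/route/tribunal) claims are never citable.»

WHY (owner d1-p2-g10, journal 2026-08-21T11:56Z l.31129: «GN-Q `SbT ⊗ ndl` (`ndlPiece_eq_outer`: ends `Ga∇C_u` (my kN + a kN′ unit-difference letter) and `Ga∇ρ_u`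
(leaf-01's needle-side letters + unit differences); first refusal leaf-01 after NP∕PN»; MINE l.31184).  The owner's frame `LocalVertexForm.exists_SbT_outer_bound`
bounds `biBubble A (SbT κ u) B (outer φ ψ)` by `K·(Φ₁Γ₀ + Φ₀Γ₁ + Φ₁Γ₁)` from WINDOW letters of the two ends `ψA`, `Bφ` near the vertex: values (Φ₀, Γ₀) and
forward UNIT DIFFERENCES (Φ₁, Γ₁).  The values are in the tree (Φ: `NeedleNdlProjLetters.exists_applyK_grad_row_le`; kN: `NeedleColumnLetters.exists_applyK_gradC_le`);
this file supplies the two unit-difference letters, each one power better than its value letter — which is what makes the local-vertex words n-uniform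
(an3-g57 §3′ (4): the `SbT` vertex «supplies two lattice differences on the legs»).

CONTENT (`a > 0`, `n ≥ 1`).
* §1 [folklore] **`applyK_diff_eq`** — `(Aφ)(x+e_i,α) − (Aφ)(x,α) = Σ'_y Σ_b (A (x+e_i) y α b − A x y α b)·φ y b` (spread leg, bounded bond function).
* §2 [folklore] **`exists_applyK_grad_row_diff_le`** (Φ′: LEFT d1 leg profile (degree 3) ⊛ d1 needle profile (degree 3) ↦ degree 2, needle weights kept, no by-parts).
* §3 [folklore] **`exists_applyK_gradC_diff_le`** (kN′: LEFT d1 leg profile, `ℓ¹` mass `O(n)` by the damped degree-3 sum, × the flat column difference `C₀∕n`: n⁰).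
NOT HERE (honest): the word, the (1.22) sum, the piece (`GluonLocalNdlRow`).
Unit `b2b-balaban-beta-d1-formalise-leaf-01` (gen 15), D1 formalisation swarm LEAF PROVER 01 on cross-road kernel duty; `LEAVES-BFx.md` row (N) «GN-Q» letters.
-/

noncomputable section

namespace Summit.QuantumFields.BalabanUV.Beta.D1BFx.GluonLocalNdlLetters

open Finset
open scoped BigOperators
open Literature.MathematicalPhysics.QuantumFieldTheory.Balaban1983to89
open Literature.MathematicalPhysics.QuantumFieldTheory.Balaban1983to89.Beta
open B12Sec2to5 (l1 l1_nonneg)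
open B6QGQLower276 (X e blk B mem_B)
open ExpKernelCalculus (Site MKer Decays summable_exp_shift)
open DyadicShell (Pt)
open Beta.PoissonInterior (nrm nrm_pos one_le_nrm nrm_neg supNorm_le_nrm)
open AffineAveraging (unitVec)
open VectorTailsLoc (fam kfam)
open Summit.QuantumFields.BalabanUV.Beta.TameKernelCalculus (Spr)
open Summit.QuantumFields.BalabanUV.Beta.D1BFx.RProjector (Pgt kerP deltaPP deltaP deltaPP_pos deltaP_pos)
open Summit.QuantumFields.BalabanUV.Beta.D1BFx.ProjectorSupNorm (cPPs cPs cPPs_nonneg cPs_nonneg)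
open Summit.QuantumFields.BalabanUV.Beta.D1BFx.GluonLeg (Ga Ga_apply Ga_symm)
open Summit.QuantumFields.BalabanUV.Beta.D1BFx.GluonLegTails (spr_Ga_of_prop12)
open Summit.QuantumFields.BalabanUV.Beta.D1BFx.FrozenLegTails (nOf MOf hn1)
open Summit.QuantumFields.BalabanUV.Beta.D1BFx.GhostStencil (qJet)
open Summit.QuantumFields.BalabanUV.Beta.D1BFx.GluonLegProfileD1 (exists_abs_Ga_diff_left_le_profile)
open Summit.QuantumFields.BalabanUV.Beta.D1BFx.RankOneBubble (applyK applyKT pairing applyK_apply)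
open Summit.QuantumFields.BalabanUV.Beta.D1BFx.RankOneBubbleJets (grad grad_apply)
open Summit.QuantumFields.BalabanUV.Beta.D1BFx.NeedlePotentialLetters (ndlRow abs_ndlRow_diff_le)
open Summit.QuantumFields.BalabanUV.Beta.D1BFx.NeedlePotentialProfile (abs_ndlRow_diff_le_needle_profile)
open Summit.QuantumFields.BalabanUV.Beta.D1BFx.RColumnBlockMass (dR cRd dR_pos cRd_nonneg)
open Summit.QuantumFields.BalabanUV.Beta.D1BFx.RColumnProfile (kP)
open Summit.QuantumFields.BalabanUV.Beta.D1BFx.NeedleColumnLetters (abs_gradC_le)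
open Summit.QuantumFields.BalabanUV.Beta.D1BFx.LatticeHLSProfiles (summable_and_abs_tsum_le_of_abs_sum_le)

variable (a : ℝ) (ha : 0 < a)

/-! ## §1 The unit difference (in the outer variable) of `applyK` -/

/-- [folklore] **THE UNIT DIFFERENCE OF `applyK` IN ITS SITE ARGUMENT IS THE ACTION OF THE LEFT-DIFFERENCED LEG**: for a spread leg and a bounded bond function,
`(Aφ)(x+e_i, α) − (Aφ)(x, α) = Σ'_y Σ_b (A (x+e_i) y α b − A x y α b)·φ y b`. -/
theorem applyK_diff_eq {A : MKer 4 (Fin 4)} (hA : Spr A) {φ : Site 4 → Fin 4 → ℝ} (hφ : ∃ M, ∀ y b, |φ y b| ≤ M) (x : Site 4) (α i : Fin 4) :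
    applyK A φ (x + unitVec i) α - applyK A φ x α = ∑' y : Site 4, ∑ b : Fin 4, (A (x + unitVec i) y α b - A x y α b) * φ y b := by
  obtain ⟨C, δ, hδ, hAd⟩ := hA
  obtain ⟨M, hM⟩ := hφ
  have hC0 : 0 ≤ C := hAd.nonneg α
  have hM0 : 0 ≤ M := (abs_nonneg _).trans (hM x α)
  have hs : ∀ z : Site 4, Summable fun y : Site 4 => ∑ b : Fin 4, A z y α b * φ y b := fun z =>
    Summable.of_norm_bounded (g := fun y => ∑ _b : Fin 4, C * Real.exp (-δ * l1 (z - y)) * M)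
      (summable_sum fun b _ => ((summable_exp_shift hδ z).mul_left C).mul_right M) fun y => by
        rw [Real.norm_eq_abs]
        refine (Finset.abs_sum_le_sum_abs _ _).trans (Finset.sum_le_sum fun b _ => ?_)
        rw [abs_mul]; exact mul_le_mul (hAd z y α b) (hM y b) (abs_nonneg _) (by positivity)
  rw [applyK_apply, applyK_apply, ← (hs (x + unitVec i)).tsum_sub (hs x)]
  refine tsum_congr fun y => ?_
  rw [← Finset.sum_sub_distrib]
  exact Finset.sum_congr rfl fun b _ => by ring

/-! ## §2 (Φ′) The unit difference of the needle end `Ga ∇row_u` — needle weights kept, degree 2 -/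

/-- [folklore] **(Φ′) `|(Ga∇row_u)(x+e_i,α) − (Ga∇row_u)(x,α)| ≤ (kΦ′∕n²)·Σ_{s∈B(blk u)}|qJet_u s|·e^{−(ε₁∕n)‖x−s‖∞}∕nrm(x−s)²`** for every `n ≥ 1`, `κ`, `u`, `x`, `α`, `i`,
modulo [B5, Prop. 1.2] ∧ [B5, (1.126)–(1.127)] BY NAME: leaf-04-g9's LEFT d1 profile of the leg `GluonLegProfileD1.exists_abs_Ga_diff_left_le_profile` (degree 3, damped)
against leaf-05's damped d1 needle profile `NeedlePotentialProfile.abs_ndlRow_diff_le_needle_profile` (degree 3), needle site by needle site through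
`LatticeHLSDamped.abs_sum_mul_le_of_damped_profiles` (3 + 3 − 4 = 2) — the unit difference gains `1∕nrm` over the Φ letter, no summation by parts. -/
theorem exists_applyK_grad_row_diff_le (h12 : B5.Prop12Printed (fam nOf hn1 MOf a ha)) (h126 : B5.Kernel126_127Printed (kfam nOf MOf)) :
    ∃ kΦ' ε₁ : ℝ, 0 < ε₁ ∧ 0 ≤ kΦ' ∧ ∀ (n : ℕ) [NeZero n] (κ : Fin 4) (u x : Pt) (α i : Fin 4),
      |applyK (Ga n a) (grad (ndlRow n a κ u)) (x + unitVec i) α - applyK (Ga n a) (grad (ndlRow n a κ u)) x α|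
        ≤ kΦ' / (n : ℝ) ^ 2 * ∑ s ∈ B (n - 1) (blk (n - 1) u), |qJet n κ u (blk (n - 1) u) s|
            * (Real.exp (-(ε₁ / n) * PoissonInterior.supNorm (d := 4) (x - s)) / nrm (x - s) ^ 2) := by
  obtain ⟨kG', δ, hδ, hkG', hd1⟩ := exists_abs_Ga_diff_left_le_profile a ha h12 h126
  have hdR := dR_pos (a := a) ha
  have hkP : 0 ≤ kP a := (RColumnProfile.kV_nonneg_and ha).2
  set ε₁ : ℝ := min δ (dR a / 2) with hε₁
  have hε₁0 : 0 < ε₁ := lt_min hδ (half_pos hdR)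
  set cH : ℝ := 4 * 2 ^ (4 + 3) * 9 ^ (4 - 1) with hcH
  refine ⟨4 * (kG' * kP a * cH), ε₁, hε₁0, by positivity, fun n _ κ u x α i => ?_⟩
  have hn : (0 : ℝ) < n := by exact_mod_cast Nat.pos_of_ne_zero (NeZero.ne n)
  have hn1 : (1 : ℝ) ≤ n := by exact_mod_cast NeZero.one_le
  set m : ℕ := n - 1 with hm
  set ε : ℝ := ε₁ / n with hε
  have hε0 : 0 ≤ ε := by positivity
  have hεδ : ε ≤ δ / n := div_le_div_of_nonneg_right (min_le_left _ _) hn.le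
  have hεR : ε ≤ dR a / 2 / n := div_le_div_of_nonneg_right (min_le_right _ _) hn.le
  have hA : Spr (Ga n a) := spr_Ga_of_prop12 (a := a) (ha := ha) h12 h126 n
  have hbdd : ∃ M, ∀ y b, |grad (ndlRow n a κ u) y b| ≤ M := ⟨((n : ℝ) ^ 4)⁻¹ * (cRd a / n * 1), fun y b => by
    rw [grad_apply]
    refine (abs_ndlRow_diff_le n κ u ha y b).trans (mul_le_mul_of_nonneg_left (mul_le_mul_of_nonneg_left ?_ (div_nonneg (cRd_nonneg ha) hn.le)) (by positivity))
    rw [Real.exp_le_one_iff]; have : 0 ≤ dR a * dist (blk m y) (blk m u) := by positivity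
    linarith⟩
  rw [applyK_diff_eq hA hbdd x α i]
  set W : Pt → ℝ := fun s => |qJet n κ u (blk m u) s| with hW
  set prof : Pt → ℝ := fun s => Real.exp (-ε * PoissonInterior.supNorm (d := 4) (x - s)) / nrm (x - s) ^ 2 with hprof
  -- the series is dominated on every finite set
  have hfin : ∀ S : Finset Pt, ∑ y ∈ S, |∑ b : Fin 4, (Ga n a (x + unitVec i) y α b - Ga n a x y α b) * grad (ndlRow n a κ u) y b|
      ≤ 4 * (kG' * kP a * cH) / (n : ℝ) ^ 2 * ∑ s ∈ B m (blk m u), W s * prof s := by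
    intro S
    -- the kernel factor: damped degree-3 profile centred at `x`
    have hK : ∀ (b : Fin 4), ∀ y ∈ S, |Ga n a (x + unitVec i) y α b - Ga n a x y α b|
        ≤ kG' * Real.exp (-ε * PoissonInterior.supNorm (d := 4) (y - x)) / nrm (y - x) ^ 3 := by
      intro b y _
      have h := hd1 n x y α b i
      rw [show BubbleTransfer.unitVec i = unitVec i from rfl] at h
      rw [show y - x = -(x - y) by abel, PoissonInterior.supNorm_neg, nrm_neg]
      refine h.trans (div_le_div_of_nonneg_right (mul_le_mul_of_nonneg_left (Real.exp_le_exp.2 ?_) hkG') (pow_nonneg (nrm_pos _).le 3))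
      have : (0 : ℝ) ≤ PoissonInterior.supNorm (d := 4) (x - y) := by positivity
      nlinarith
    -- the needle d1 profile
    have hrow : ∀ (y : Pt) (b : Fin 4), |grad (ndlRow n a κ u) y b| ≤ ∑ s ∈ B m (blk m u), W s *
        (kP a / (n : ℝ) ^ 2 * Real.exp (-ε * PoissonInterior.supNorm (d := 4) (y - s)) / nrm (y - s) ^ 3) := by
      intro y b
      rw [grad_apply]
      refine (abs_ndlRow_diff_le_needle_profile n κ u ha y b).trans (Finset.sum_le_sum fun s _ => ?_)
      refine mul_le_mul_of_nonneg_left (div_le_div_of_nonneg_right (mul_le_mul_of_nonneg_left (Real.exp_le_exp.2 ?_) (by positivity))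
        (pow_nonneg (nrm_pos _).le 3)) (abs_nonneg _)
      have : (0 : ℝ) ≤ PoissonInterior.supNorm (d := 4) (y - s) := by positivity
      nlinarith
    have hb : ∀ b : Fin 4, ∑ y ∈ S, |(Ga n a (x + unitVec i) y α b - Ga n a x y α b) * grad (ndlRow n a κ u) y b|
        ≤ kG' * kP a * cH / (n : ℝ) ^ 2 * ∑ s ∈ B m (blk m u), W s * prof s := by
      intro b
      calc ∑ y ∈ S, |(Ga n a (x + unitVec i) y α b - Ga n a x y α b) * grad (ndlRow n a κ u) y b|
          ≤ ∑ y ∈ S, |Ga n a (x + unitVec i) y α b - Ga n a x y α b| * ∑ s ∈ B m (blk m u), W s *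
              (kP a / (n : ℝ) ^ 2 * Real.exp (-ε * PoissonInterior.supNorm (d := 4) (y - s)) / nrm (y - s) ^ 3) :=
            Finset.sum_le_sum fun y _ => by rw [abs_mul]; exact mul_le_mul_of_nonneg_left (hrow y b) (abs_nonneg _)
        _ = ∑ s ∈ B m (blk m u), W s * ∑ y ∈ S, |Ga n a (x + unitVec i) y α b - Ga n a x y α b| *
              (kP a / (n : ℝ) ^ 2 * Real.exp (-ε * PoissonInterior.supNorm (d := 4) (y - s)) / nrm (y - s) ^ 3) := by
            simp only [Finset.mul_sum]
            rw [Finset.sum_comm]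
            exact Finset.sum_congr rfl fun s _ => Finset.sum_congr rfl fun y _ => by ring
        _ ≤ ∑ s ∈ B m (blk m u), W s * (kG' * (kP a / (n : ℝ) ^ 2) * cH * prof s) := by
            refine Finset.sum_le_sum fun s _ => mul_le_mul_of_nonneg_left ?_ (abs_nonneg _)
            have hf0 : ∀ y : Pt, 0 ≤ kP a / (n : ℝ) ^ 2 * Real.exp (-ε * PoissonInterior.supNorm (d := 4) (y - s)) / nrm (y - s) ^ 3 := fun y =>
              div_nonneg (mul_nonneg (div_nonneg hkP (pow_nonneg hn.le 2)) (Real.exp_pos _).le) (pow_nonneg (nrm_pos _).le 3)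
            have h := LatticeHLSDamped.abs_sum_mul_le_of_damped_profiles (d := 4) (by norm_num) (a := 3) (b := 3) (by norm_num) (by norm_num)
              (by norm_num) (K := fun y => Ga n a (x + unitVec i) y α b - Ga n a x y α b)
              (f := fun y => kP a / (n : ℝ) ^ 2 * Real.exp (-ε * PoissonInterior.supNorm (d := 4) (y - s)) / nrm (y - s) ^ 3)
              (κ := kG') (A := kP a / (n : ℝ) ^ 2) (ε := ε) hkG' (div_nonneg hkP (pow_nonneg hn.le 2)) hε0 S x s (hK b) (fun y _ => by
                rw [abs_of_nonneg (hf0 y), mul_div_assoc])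
            refine le_trans (le_of_eq (Finset.sum_congr rfl fun y _ => ?_)) (h.trans (le_of_eq ?_))
            · rw [abs_mul, abs_of_nonneg (hf0 y)]
            · rw [hcH, hprof, show (3 + 3 - 4 : ℕ) = 2 by norm_num]; norm_num; ring
        _ = kG' * kP a * cH / (n : ℝ) ^ 2 * ∑ s ∈ B m (blk m u), W s * prof s := by
            rw [Finset.mul_sum]; exact Finset.sum_congr rfl fun s _ => by field_simp
    calc ∑ y ∈ S, |∑ b : Fin 4, (Ga n a (x + unitVec i) y α b - Ga n a x y α b) * grad (ndlRow n a κ u) y b|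
        ≤ ∑ y ∈ S, ∑ b : Fin 4, |(Ga n a (x + unitVec i) y α b - Ga n a x y α b) * grad (ndlRow n a κ u) y b| :=
          Finset.sum_le_sum fun y _ => Finset.abs_sum_le_sum_abs _ _
      _ = ∑ b : Fin 4, ∑ y ∈ S, |(Ga n a (x + unitVec i) y α b - Ga n a x y α b) * grad (ndlRow n a κ u) y b| := Finset.sum_comm
      _ ≤ ∑ _b : Fin 4, kG' * kP a * cH / (n : ℝ) ^ 2 * ∑ s ∈ B m (blk m u), W s * prof s := Finset.sum_le_sum fun b _ => hb b
      _ = 4 * (kG' * kP a * cH) / (n : ℝ) ^ 2 * ∑ s ∈ B m (blk m u), W s * prof s := by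
          rw [Finset.sum_const, Finset.card_univ, Fintype.card_fin, nsmul_eq_mul]; push_cast; ring
  refine (summable_and_abs_tsum_le_of_abs_sum_le hfin).2.trans (le_of_eq ?_)
  rw [hW, hprof, hε]

/-! ## §3 (kN′) The unit difference of the column end `Ga ∇C_u` — `n⁰`, the gain `n⁻¹` over kN -/

/-- [folklore] **(kN′) `|(Ga∇C_u)(x+e_i,α) − (Ga∇C_u)(x,α)| ≤ kN′·(|cQ|·cPPs + cPs)`** for every `n ≥ 1`, `cQ`, `u`, `x`, `α`, `i`, modulo [B5, Prop. 1.2] ∧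
[B5, (1.126)–(1.127)] BY NAME: the LEFT d1 profile of the leg (degree 3, damped at scale `n`: its `ℓ¹` mass is `O(n)` by `LatticeHLSRadial.sum_exp_div_nrm_pow_le`)
against the owner's flat column difference `NeedleColumnLetters.abs_gradC_le` (`C₀∕n`, its block decay dropped): `n · n⁻¹ = n⁰`. -/
theorem exists_applyK_gradC_diff_le (h12 : B5.Prop12Printed (fam nOf hn1 MOf a ha)) (h126 : B5.Kernel126_127Printed (kfam nOf MOf)) :
    ∃ kN' : ℝ, 0 ≤ kN' ∧ ∀ (n : ℕ) [NeZero n] (cQ : ℝ) (u x : Pt) (α i : Fin 4),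
      |applyK (Ga n a) (grad (fun q => cQ * (∑ z ∈ B (n - 1) (blk (n - 1) u), Pgt n a z q () ()) - kerP (d := 4) (n - 1) a q (blk (n - 1) u))) (x + unitVec i) α
        - applyK (Ga n a) (grad (fun q => cQ * (∑ z ∈ B (n - 1) (blk (n - 1) u), Pgt n a z q () ()) - kerP (d := 4) (n - 1) a q (blk (n - 1) u))) x α|
        ≤ kN' * (|cQ| * cPPs 4 a + cPs 4 a) := by
  obtain ⟨kG', δ, hδ, hkG', hd1⟩ := exists_abs_Ga_diff_left_le_profile a ha h12 h126
  have hPP := deltaPP_pos 4 ha; have hP := deltaP_pos 4 ha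
  have hcP := cPPs_nonneg 4 ha; have hcs := cPs_nonneg 4 ha
  set δC : ℝ := min (deltaPP 4 a) (deltaP 4 a) with hδC
  have hδC0 : 0 < δC := lt_min hPP hP
  set cR₃ : ℝ := 2 * (Nat.factorial 0) * (2 / δ) ^ 0 *
    (1 + 2 * (4 : ℕ) * 3 ^ (4 - 1) * ((Nat.factorial (4 - 1 - 3)) * (4 / δ) ^ (4 - 1 - 3) * (1 + 4 / δ))) with hcR₃
  have hcR₃0 : 0 ≤ cR₃ := by positivity
  refine ⟨4 * kG' * cR₃, by positivity, fun n _ cQ u x α i => ?_⟩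
  have hn : (0 : ℝ) < n := by exact_mod_cast Nat.pos_of_ne_zero (NeZero.ne n)
  have hn1 : 1 ≤ n := NeZero.one_le
  set m : ℕ := n - 1 with hm
  set Cf : Pt → ℝ := fun q => cQ * (∑ z ∈ B m (blk m u), Pgt n a z q () ()) - kerP (d := 4) m a q (blk m u) with hCf
  set C₀ : ℝ := |cQ| * cPPs 4 a + cPs 4 a with hC₀
  have hC₀0 : 0 ≤ C₀ := by positivity
  have hA : Spr (Ga n a) := spr_Ga_of_prop12 (a := a) (ha := ha) h12 h126 n
  -- the flat column difference (block decay dropped)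
  have hC : ∀ (y : Pt) (b : Fin 4), |grad Cf y b| ≤ C₀ / (n : ℝ) := by
    intro y b
    refine (abs_gradC_le a ha n cQ u y b).trans (mul_le_of_le_one_right (by positivity) ?_)
    rw [Real.exp_le_one_iff]; have : 0 ≤ δC * dist (blk m u) (blk m y) := by positivity
    linarith
  rw [applyK_diff_eq hA ⟨_, hC⟩ x α i]
  -- the damped degree-3 sum is `O(n)`
  have hR₃ : ∀ S : Finset Pt, ∑ y ∈ S, Real.exp (-(δ / n) * PoissonInterior.supNorm (d := 4) (y - x)) / nrm (y - x) ^ 3 ≤ cR₃ * (n : ℝ) := by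
    intro S
    have h := LatticeHLSProfiles.sum_pow_mul_exp_div_nrm_pow_free_scale_le (d := 4) (by norm_num) hδ hn1 (p := 3) (by norm_num) 0 S x x
    simp only [pow_zero, one_mul] at h
    refine h.trans (le_of_eq ?_)
    rw [hcR₃, show (4 - 3 + 0 : ℕ) = 1 by norm_num, pow_one]
    simp only [pow_zero, Nat.factorial]
  have hfin : ∀ S : Finset Pt, ∑ y ∈ S, |∑ b : Fin 4, (Ga n a (x + unitVec i) y α b - Ga n a x y α b) * grad Cf y b| ≤ 4 * kG' * cR₃ * C₀ := by
    intro S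
    have hterm : ∀ (y : Pt) (b : Fin 4), |(Ga n a (x + unitVec i) y α b - Ga n a x y α b) * grad Cf y b|
        ≤ kG' * Real.exp (-(δ / n) * PoissonInterior.supNorm (d := 4) (y - x)) / nrm (y - x) ^ 3 * (C₀ / (n : ℝ)) := by
      intro y b
      rw [abs_mul]
      have h := hd1 n x y α b i
      rw [show BubbleTransfer.unitVec i = unitVec i from rfl] at h
      rw [show y - x = -(x - y) by abel, PoissonInterior.supNorm_neg, nrm_neg]
      exact mul_le_mul h (hC y b) (abs_nonneg _) (div_nonneg (mul_nonneg hkG' (Real.exp_pos _).le) (pow_nonneg (nrm_pos _).le 3))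
    calc ∑ y ∈ S, |∑ b : Fin 4, (Ga n a (x + unitVec i) y α b - Ga n a x y α b) * grad Cf y b|
        ≤ ∑ y ∈ S, ∑ b : Fin 4, |(Ga n a (x + unitVec i) y α b - Ga n a x y α b) * grad Cf y b| :=
          Finset.sum_le_sum fun y _ => Finset.abs_sum_le_sum_abs _ _
      _ ≤ ∑ y ∈ S, ∑ _b : Fin 4, kG' * Real.exp (-(δ / n) * PoissonInterior.supNorm (d := 4) (y - x)) / nrm (y - x) ^ 3 * (C₀ / (n : ℝ)) :=
          Finset.sum_le_sum fun y _ => Finset.sum_le_sum fun b _ => hterm y b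
      _ = 4 * kG' * (C₀ / (n : ℝ)) * ∑ y ∈ S, Real.exp (-(δ / n) * PoissonInterior.supNorm (d := 4) (y - x)) / nrm (y - x) ^ 3 := by
          rw [Finset.mul_sum]
          refine Finset.sum_congr rfl fun y _ => ?_
          rw [Finset.sum_const, Finset.card_univ, Fintype.card_fin, nsmul_eq_mul]; push_cast; ring
      _ ≤ 4 * kG' * (C₀ / (n : ℝ)) * (cR₃ * (n : ℝ)) := mul_le_mul_of_nonneg_left (hR₃ S) (by positivity)
      _ = 4 * kG' * cR₃ * C₀ := by field_simp
  refine (summable_and_abs_tsum_le_of_abs_sum_le hfin).2.trans (le_of_eq ?_)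
  rw [hC₀]

end Summit.QuantumFields.BalabanUV.Beta.D1BFx.GluonLocalNdlLetters

end
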